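import Summits.ResolutionOfSingularities.ResolutionOfSingularities.Theorems.PurelyInseparableDim4ScopeBlindGcdLeaf
import HarnessLib

/-!
# `gcdLeafB`: the 𝔽_p CERTIFICATE FORMAT of the GCD LEAF — three decidable identities on term lists, blindness at every point of
# `{x_T = 0, h = 0}` over every field (cell `res-dim4-pi`, ∀K column; interface of res-dim4-typ-3g9's row checker)

[OURS · counted 0 · certificate format for OUR frame] Nothing here is a statement about resolution of singularities.
Seat res-dim4-p-8 g4.  `…ScopeBlindGcdLeaf` proved `ScopeBlind.not_inCoordinateScope_step_of_gcdLeaf`; this file turns its hypotheses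
into a Boolean on term lists (pattern of `substBlindB` p683502 / `laurentBlindB` p686027) and transports them along any `f : k →+* K`:

* §1 the BÉZOUT certificate for hypothesis (ii) «`h` vanishes identically on no hyperplane `{x_i = β}`»: `aeval_freeze_monomial`,
  `sliceL i m L` (the `x_i`-slice of `L` at the monomial `m` in the other variables = res-dim4-eng-w2's coefficient polynomial `h_k(u)`,
  `u = x_i`, of `μ_k = x^m`), `eval_map_sliceL` (its value at `β·e_i` is the coefficient of `x^{m}` in `h(x_i ↦ β)`), `bezoutL`
  (`Σ_k c_k · sliceL i m_k h`), **`aeval_freeze_ne_zero_of_bezoutB`** (`bezoutL ≡ 1` over `k` ⟹ `h(x_i ↦ β) ≠ 0` over every `K ⊇ k`);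
* §2 **`gcdLeafB p G T h cof bez α₀ : Bool`** — `h` free of `x_T`; (i) `killT (hasseL α G) ≡ (cof α) · h` for every `α ∈ idxLT p`;
  (ii) `bezoutL i h (bez i) ≡ 1` for every `i ∉ T`; (iii) `0 < |α₀| < p` and `killT (hasseL α₀ G) ≢ 0` — and
  **`not_inCoordinateScope_step_map_of_gcdLeafB`**: for a presented state `s` over `k`, `gcdLeafB p (chartL p S j s.L) … = true` ⟹
  for EVERY field `K` of characteristic `p`, every `f : k →+* K`, every `b ∈ K⁴` with `b_T = 0` and `h(b) = 0`, the child
  `CentreBlowup.step p S j b (s ⊗ K)` is OUT of coordinate scope; `_cast_` entry for `k = ZMod p`;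
* §3 acceptance (`decide`, `p = 2`): eng-w2's row 2 of `en9gcdleaf.tsv` a9620a43615b73f0 — root `S1a-0d464eef23` = `x₃x₄² + x₃²x₄ + x₂x₄³`,
  centre `V(z, x₁, x₃, x₄)`, chart `x₃`, `G = x₃x₄ + x₃x₄² + x₂x₃x₄³`, `T = {x₃}`, `h = x₂x₄² + x₄ + 1` (a cubic cylinder with no
  polynomial retraction) with the NON-trivial Bézout `1·u² + (u + 1)·(u + 1) = 1` in `𝔽₂[u = x₄]` (`gcdLeafB_cubicSpec`); hence
  **`cubicSpec_children_blind`**: over every field of characteristic 2, at every `b` with `b₃ = 0`, `b₂b₄² + b₄ + 1 = 0` the child is blind.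

Row data for the other 110 loci: `pub/res-dim4/res-dim4-eng-w2/jobs/j321292-en9E-rootblocked23/gcdleaf-j322246/en9gcdleaf.jsonl`
(per row: `T`, `h`, cofactors (i), Bézout data (ii) per free variable, `α₀` (iii)); for a variable `x_i ∉ T` NOT occurring in `h` the
Bézout entry is the constant slice (`m` = any monomial of `h`, `c` = the inverse of its coefficient).  OURS; counted 0.
bears_on: LADDER-RESOLUTION:D157-DOOR2 (res-dim4-pi · ∀K column · certificate KIND «GCD leaf»).  Supports stmt-ResolutionOfSingularities-16155 (helper).
-/

set_option linter.dupNamespace false -- mandated namespace of this single-conjunct summit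

noncomputable section

open MvPolynomial Finset
open scoped BigOperators

namespace Summit.ResolutionOfSingularities.ResolutionOfSingularities.Theorems.PIDim4

namespace ScopeBlind

open Literature.AlgebraicGeometry.Resolution
open Literature.AlgebraicGeometry.Resolution.CentreBlowup
open Literature.AlgebraicGeometry.Resolution.Hauser2010
open StepKit ScopeCover ScopeDynamics IsolationCert CurveBlind

/-! ## §1 The Bézout certificate: `h` vanishes identically on no coordinate hyperplane, over every field -/

section Freeze

variable {K : Type} [Field K]

/-- **a frozen monomial**: `x^d (x_i ↦ β) = β^{d_i} · x^{d − d_i e_i}`. [folklore] -/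
theorem aeval_freeze_monomial (i : Fin 4) (β : K) (d : Fin 4 → ℕ) (c : K) :
    MvPolynomial.aeval (R := K) (fun j : Fin 4 => if j = i then C β else (X j : MvPolynomial (Fin 4) K))
        (monomial (expo d) c) =
      monomial (expo (Function.update d i 0)) (c * β ^ (d i)) := by
  classical
  have hsplit : expo d = expo (Function.update d i 0) + Finsupp.single i (d i) := by
    ext j
    rw [Finsupp.add_apply, expo_apply, expo_apply, Function.update_apply, Finsupp.single_apply]
    by_cases hj : j = i
    · subst hj
      rw [if_pos rfl, if_pos rfl, zero_add]
    · rw [if_neg hj, if_neg (Ne.symm hj), add_zero]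
  have hmon : monomial (expo d) c = monomial (expo (Function.update d i 0)) c * (X i : MvPolynomial (Fin 4) K) ^ (d i) := by
    rw [X_pow_eq_monomial, monomial_mul, mul_one, ← hsplit]
  have hfix : MvPolynomial.aeval (R := K) (fun j : Fin 4 => if j = i then C β else (X j : MvPolynomial (Fin 4) K))
      (monomial (expo (Function.update d i 0)) c) = monomial (expo (Function.update d i 0)) c := by
    rw [MvPolynomial.aeval_monomial, MvPolynomial.algebraMap_eq, monomial_eq]
    congr 1
    refine Finsupp.prod_congr fun j hj => ?_
    have hji : j ≠ i := by
      intro hji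
      rw [Finsupp.mem_support_iff, expo_apply, hji, Function.update_self] at hj
      exact hj rfl
    rw [if_neg hji]
  rw [hmon, map_mul, map_pow, hfix, MvPolynomial.aeval_X, if_pos rfl, ← C_pow, mul_comm, C_mul_monomial, mul_comm]

end Freeze

section Bezout

variable {k : Type} [Field k]

/-- **the `x_i`-slice of a term list at `m`**: the terms `c · x^d` whose exponent agrees with `m` OFF `i`, re-read as `c · x_i^{d_i}`
(eng-w2's coefficient polynomial `h_k(u)`, `u = x_i`, of the monomial `μ_k = x^m` in the other variables). [OURS · instrument] -/
def sliceL (i : Fin 4) (m : Fin 4 → ℕ) (L : Terms 4 k) : Terms 4 k :=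
  (L.filter fun t => Function.update t.1 i 0 = Function.update m i 0).map fun t => ((Pi.single i (t.1 i) : Fin 4 → ℕ), t.2)

omit [Field k] in
/-- `sliceL` on a cons. [folklore] -/
theorem sliceL_cons (i : Fin 4) (m : Fin 4 → ℕ) (t : (Fin 4 → ℕ) × k) (L : Terms 4 k) :
    sliceL i m (t :: L) =
      if Function.update t.1 i 0 = Function.update m i 0 then ((Pi.single i (t.1 i) : Fin 4 → ℕ), t.2) :: sliceL i m L
      else sliceL i m L := by
  by_cases h : Function.update t.1 i 0 = Function.update m i 0 <;> simp [sliceL, h]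

/-- `expo (Pi.single i n) = single i n`. [folklore] -/
theorem expo_pi_single_eq (i : Fin 4) (n : ℕ) : expo (Pi.single i n : Fin 4 → ℕ) = Finsupp.single i n := by
  classical
  ext j
  rw [expo_apply, Finsupp.single_apply, Pi.single_apply]
  by_cases h : j = i
  · subst h; simp
  · rw [if_neg h, if_neg (Ne.symm h)]

/-- **the slice reads a coefficient of the frozen polynomial**: the value of the mapped slice at `β·e_i` is the coefficient of
`x^{m(x_i ↦ 0)}` in `h(x_i ↦ β)` (over any `K ⊇ k`). [folklore] -/
theorem eval_map_sliceL {K : Type} [Field K] (f : k →+* K) (i : Fin 4) (m : Fin 4 → ℕ) (β : K) (L : Terms 4 k) :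
    MvPolynomial.eval (Pi.single i β : Fin 4 → K) (MvPolynomial.map f (evalT (sliceL i m L))) =
      coeff (expo (Function.update m i 0))
        (MvPolynomial.aeval (R := K) (fun j : Fin 4 => if j = i then C β else (X j : MvPolynomial (Fin 4) K))
          (MvPolynomial.map f (evalT L))) := by
  classical
  induction L with
  | nil => simp [sliceL]
  | cons t L ih =>
    rw [sliceL_cons, evalT_cons, map_add, map_add, coeff_add, MvPolynomial.map_monomial, aeval_freeze_monomial,
      coeff_monomial, ← ih]
    by_cases ht : Function.update t.1 i 0 = Function.update m i 0
    · rw [if_pos ht, if_pos (by rw [ht]), evalT_cons, map_add, map_add, MvPolynomial.map_monomial, expo_pi_single_eq,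
        MvPolynomial.eval_monomial, Finsupp.prod_single_index (by simp), Pi.single_eq_same]
    · rw [if_neg ht, if_neg (fun h => ht (expo_inj.mp h)), zero_add]

/-- **the Bézout combination** `Σ_k c_k · sliceL i m_k h` of a list of (monomial, multiplier) pairs. [OURS · instrument] -/
def bezoutL (i : Fin 4) (h : Terms 4 k) : List ((Fin 4 → ℕ) × Terms 4 k) → Terms 4 k
  | [] => []
  | mc :: rest => mulL mc.2 (sliceL i mc.1 h) ++ bezoutL i h rest

/-- if `h(x_i ↦ β) = 0` then every Bézout combination vanishes at `β·e_i`. [folklore] -/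
theorem eval_map_bezoutL_eq_zero {K : Type} [Field K] (f : k →+* K) (i : Fin 4) (h : Terms 4 k) (β : K)
    (h0 : MvPolynomial.aeval (R := K) (fun j : Fin 4 => if j = i then C β else (X j : MvPolynomial (Fin 4) K))
      (MvPolynomial.map f (evalT h)) = 0)
    (l : List ((Fin 4 → ℕ) × Terms 4 k)) :
    MvPolynomial.eval (Pi.single i β : Fin 4 → K) (MvPolynomial.map f (evalT (bezoutL i h l))) = 0 := by
  induction l with
  | nil => simp [bezoutL]
  | cons mc l ih =>
    rw [bezoutL, evalT_append, map_add, map_add, ih, add_zero, evalT_mulL, map_mul, map_mul, eval_map_sliceL, h0, coeff_zero,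
      mul_zero]

variable [DecidableEq k]

/-- **BÉZOUT ⟹ NO HYPERPLANE**: if `Σ_k c_k · sliceL i m_k h ≡ 1` over `k`, then over EVERY field `K ⊇ k` and every `β ∈ K`,
`h(x_i ↦ β) ≠ 0` — `h` vanishes identically on no hyperplane `{x_i = β}`. OURS. [folklore] -/
theorem aeval_freeze_ne_zero_of_bezoutB {K : Type} [Field K] (f : k →+* K) (i : Fin 4) (h : Terms 4 k)
    (l : List ((Fin 4 → ℕ) × Terms 4 k)) (hbz : StepKit.equivB (bezoutL i h l) [(fun _ => 0, 1)] = true) (β : K) :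
    MvPolynomial.aeval (R := K) (fun j : Fin 4 => if j = i then C β else (X j : MvPolynomial (Fin 4) K))
      (MvPolynomial.map f (evalT h)) ≠ 0 := by
  intro h0
  have hid : evalT (bezoutL i h l) = 1 := by
    rw [(evalT_eq_iff_equivB _ _).mpr hbz, evalT_cons, evalT_nil, add_zero]
    show monomial (expo fun _ : Fin 4 => (0 : ℕ)) (1 : k) = 1
    rw [show expo (fun _ : Fin 4 => (0 : ℕ)) = 0 from Finsupp.ext fun _ => rfl, ← C_apply, C_1]
  have h1 := eval_map_bezoutL_eq_zero f i h β h0 l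
  rw [hid, map_one, map_one] at h1
  exact one_ne_zero h1

end Bezout

/-! ## §2 The checker `gcdLeafB` and its soundness over every field -/

section Cert

variable {k : Type} [Field k] [DecidableEq k]

/-- **`gcdLeafB p G T h cof bez α₀`** — the GCD-leaf certificate on term lists: `h` free of `x_T`; (i) for every Hasse index
`α ∈ idxLT p`, `killT (hasseL α G) ≡ (cof α) · h`; (ii) for every `i ∉ T`, the Bézout combination `bezoutL i h (bez i) ≡ 1`;
(iii) `0 < |α₀| < p` and `killT (hasseL α₀ G) ≢ 0`. [OURS · instrument] -/
def gcdLeafB (p : ℕ) (G : Terms 4 k) (T : Finset (Fin 4)) (h : Terms 4 k) (cof : (Fin 4 → ℕ) → Terms 4 k)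
    (bez : Fin 4 → List ((Fin 4 → ℕ) × Terms 4 k)) (α₀ : Fin 4 → ℕ) : Bool :=
  (h.all fun t => decide (∀ i ∈ T, t.1 i = 0)) &&
    ((idxLT p).all fun α => StepKit.equivB (killTL T (hasseL α G)) (mulL (cof α) h)) &&
    decide (∀ i : Fin 4, i ∉ T → StepKit.equivB (bezoutL i h (bez i)) [(fun _ => 0, 1)] = true) &&
    decide (0 < ∑ i, α₀ i ∧ ∑ i, α₀ i < p) &&
    !(StepKit.equivB (killTL T (hasseL α₀ G)) [])

/-- **SOUNDNESS of `gcdLeafB` over EVERY field of characteristic `p`** (res-dim4-typ-3g9's row interface).  If the certificate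
checks for a presented state `s` over `k` (chart data `S, j`), then along every `f : k →+* K`, at EVERY `b ∈ K⁴` with `b_T = 0` and
`h(b) = 0` (`h` read in `K`), the child `CentreBlowup.step p S j b (s ⊗ K)` is OUT of coordinate scope. OURS. [folklore] -/
theorem not_inCoordinateScope_step_map_of_gcdLeafB {p : ℕ} [Fact p.Prime] {s : SData 4 k} {S : Finset (Fin 4)} {j : Fin 4}
    {T : Finset (Fin 4)} {h : Terms 4 k} {cof : (Fin 4 → ℕ) → Terms 4 k} {bez : Fin 4 → List ((Fin 4 → ℕ) × Terms 4 k)}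
    {α₀ : Fin 4 → ℕ} (hc : gcdLeafB p (chartL p S j s.L) T h cof bez α₀ = true)
    (K : Type) [Field K] [CharP K p] [DecidableEq K] (f : k →+* K) (b : Fin 4 → K) (hbT : ∀ i ∈ T, b i = 0)
    (hbh : MvPolynomial.eval b (MvPolynomial.map f (evalT h)) = 0) :
    ¬ InCoordinateScope p
      (CentreBlowup.step p S j b (⟨MvPolynomial.map f s.toState.F, s.toState.r, s.toState.exc⟩ : State K)).F := by
  classical
  simp only [gcdLeafB, Bool.and_eq_true, decide_eq_true_eq, List.all_eq_true, Bool.not_eq_true'] at hc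
  obtain ⟨⟨⟨⟨hfree, hJ⟩, hbez⟩, hα₀⟩, hW⟩ := hc
  have hdeg : (expo α₀).degree = ∑ i, α₀ i := degree_expo α₀
  have hG : chartTransform p S j (MvPolynomial.map f s.toState.F) = MvPolynomial.map f (evalT (chartL p S j s.L)) := by
    rw [SData.toState_F, WinCertAllFields.chartTransform_map, chartTransform_evalT]
  -- `h` is free of `x_T`
  have hhT : MvPolynomial.aeval (R := K) (fun i : Fin 4 => if i ∈ T then (0 : MvPolynomial (Fin 4) K) else X i)
      (MvPolynomial.map f (evalT h)) = MvPolynomial.map f (evalT h) := by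
    have hfilt : (h.filter fun t => ∀ i ∈ T, t.1 i = 0) = h := List.filter_eq_self.mpr fun t ht => decide_eq_true (hfree t ht)
    rw [aeval_killT_map, aeval_killT_evalT, hfilt]
  -- certificate (i)
  have hJK : ∀ α : Fin 4 →₀ ℕ, 0 < α.degree → α.degree < p → ∃ c : MvPolynomial (Fin 4) K,
      MvPolynomial.aeval (R := K) (fun i : Fin 4 => if i ∈ T then (0 : MvPolynomial (Fin 4) K) else X i)
        (hasseDeriv α (chartTransform p S j (MvPolynomial.map f s.toState.F))) = c * MvPolynomial.map f (evalT h) := by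
    intro α h0 hq
    refine ⟨MvPolynomial.map f (evalT (cof ⇑α)), ?_⟩
    have hz := hJ (⇑α) (mem_idxLT h0 hq)
    rw [← evalT_eq_iff_equivB, killTL, ← aeval_killT_evalT, evalT_mulL, ← hasseDeriv_evalT, expo_coe] at hz
    have hzK := congrArg (MvPolynomial.map f) hz
    rw [← aeval_killT_map, ← IsolationConverse.hasseDeriv_map, ← hG, map_mul] at hzK
    exact hzK
  -- certificate (ii)
  have hXK : ∀ i : Fin 4, i ∉ T → ∀ β : K,
      MvPolynomial.aeval (R := K) (fun j : Fin 4 => if j = i then C β else (X j : MvPolynomial (Fin 4) K))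
        (MvPolynomial.map f (evalT h)) ≠ 0 :=
    fun i hiT β => aeval_freeze_ne_zero_of_bezoutB f i h (bez i) (hbez i hiT) β
  -- certificate (iii)
  have hWK : MvPolynomial.aeval (R := K) (fun i : Fin 4 => if i ∈ T then (0 : MvPolynomial (Fin 4) K) else X i)
      (hasseDeriv (expo α₀) (chartTransform p S j (MvPolynomial.map f s.toState.F))) ≠ 0 := by
    rw [hG, IsolationConverse.hasseDeriv_map, aeval_killT_map, hasseDeriv_evalT, aeval_killT_evalT]
    intro h0
    apply (not_congr (evalT_eq_zero_iff _)).mpr (by rw [killTL] at hW; rw [hW]; exact Bool.false_ne_true)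
    exact (map_eq_zero_iff _ (MvPolynomial.map_injective f f.injective)).mp h0
  exact not_inCoordinateScope_step_of_gcdLeaf p S j
    (⟨MvPolynomial.map f s.toState.F, s.toState.r, s.toState.exc⟩ : State K) (MvPolynomial.map f (evalT h)) T hhT hJK hXK
    (expo α₀) (by rw [hdeg]; exact hα₀.1) (by rw [hdeg]; exact hα₀.2) hWK b hbT hbh

/-- the `ZMod p` entry point: every field of characteristic `p`. OURS. [folklore] -/
theorem not_inCoordinateScope_step_cast_of_gcdLeafB {p : ℕ} [Fact p.Prime] {s : SData 4 (ZMod p)} {S : Finset (Fin 4)}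
    {j : Fin 4} {T : Finset (Fin 4)} {h : Terms 4 (ZMod p)} {cof : (Fin 4 → ℕ) → Terms 4 (ZMod p)}
    {bez : Fin 4 → List ((Fin 4 → ℕ) × Terms 4 (ZMod p))} {α₀ : Fin 4 → ℕ}
    (hc : gcdLeafB p (chartL p S j s.L) T h cof bez α₀ = true)
    (K : Type) [Field K] [CharP K p] [DecidableEq K] (b : Fin 4 → K) (hbT : ∀ i ∈ T, b i = 0)
    (hbh : MvPolynomial.eval b (MvPolynomial.map (ZMod.castHom (dvd_refl p) K) (evalT h)) = 0) :
    ¬ InCoordinateScope p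
      (CentreBlowup.step p S j b
        (⟨MvPolynomial.map (ZMod.castHom (dvd_refl p) K) s.toState.F, s.toState.r, s.toState.exc⟩ : State K)).F :=
  not_inCoordinateScope_step_map_of_gcdLeafB hc K (ZMod.castHom (dvd_refl p) K) b hbT hbh

end Cert

/-! ## §3 Acceptance: eng-w2's row 2 (root `S1a-0d464eef23`, centre `x₁x₃x₄`, chart `x₃`) — a NON-trivial Bézout, by `decide` -/

section Acceptance

/-- the root `x₃x₄² + x₃²x₄ + x₂x₄³` of the (2,2) ∀K column over `𝔽₂` (`r = 0`, `exc = ∅`); its `x₃`-chart child under the blow-up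
of `V(z, x₁, x₃, x₄)` is `G = x₃x₄² + x₃x₄ + x₂x₃x₄³`, whose 2-fold locus on `E = {x₃ = 0}` is the cubic cylinder
`{x₃ = 0, x₂x₄² + x₄ + 1 = 0}` (eng-w2: LAURENT class, UNIFORM-OUT). [OURS · specimen] -/
def cubicSpec : SData 4 (ZMod 2) := ⟨[(![0, 0, 1, 2], 1), (![0, 0, 2, 1], 1), (![0, 1, 0, 3], 1)], ![0, 0, 0, 0], ∅⟩

/-- certificate (i): only `∂₃G = x₄² + x₄ + x₂x₄³ = x₄ · h` survives `x₃ ↦ 0`. [OURS · specimen] -/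
def cubicCof : (Fin 4 → ℕ) → Terms 4 (ZMod 2) := fun α => if α = ![0, 0, 1, 0] then [(![0, 0, 0, 1], 1)] else []

/-- certificate (ii): `x₁`, `x₂` — the constant slice `1`; `x₄` — slices `u²` (at `x₂`) and `u + 1` (at `1`) with the Bézout
`1 · u² + (u + 1) · (u + 1) = 1` in `𝔽₂[u]`. [OURS · specimen] -/
def cubicBez : Fin 4 → List ((Fin 4 → ℕ) × Terms 4 (ZMod 2)) :=
  ![[(![0, 0, 0, 0], [(![0, 0, 0, 0], 1)])], [(![0, 0, 0, 0], [(![0, 0, 0, 0], 1)])], [],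
    [(![0, 1, 0, 0], [(![0, 0, 0, 0], 1)]), (![0, 0, 0, 0], [(![0, 0, 0, 1], 1), (![0, 0, 0, 0], 1)])]]

/-- the GCD-leaf certificate of the cubic cylinder (`T = {x₃}`, `h = x₂x₄² + x₄ + 1`, `α₀ = e₃`) checks, by `decide`. [OURS · ‖ K] -/
theorem gcdLeafB_cubicSpec :
    gcdLeafB 2 (chartL 2 {0, 2, 3} 2 cubicSpec.L) {2} [(![0, 1, 0, 2], 1), (![0, 0, 0, 1], 1), (![0, 0, 0, 0], 1)] cubicCof cubicBez
      ![0, 0, 1, 0] = true := by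
  decide

/-- **hence over EVERY field `K` of characteristic `2`, at EVERY point `b` of the exceptional divisor `{x₃ = 0}` lying on the cubic
cylinder `b₂b₄² + b₄ + 1 = 0`, the child of `x₃x₄² + x₃²x₄ + x₂x₄³` (centre `V(z, x₁, x₃, x₄)`, chart `x₃`) is OUT of coordinate
scope** — a locus with no polynomial retraction, certified without 𝔽₄, localisation or parametrisation. [OURS · ‖ K] -/
theorem cubicSpec_children_blind (K : Type) [Field K] [CharP K 2] [DecidableEq K] (b : Fin 4 → K) (hb3 : b 2 = 0)
    (hZ : b 1 * b 3 ^ 2 + b 3 + 1 = 0) :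
    ¬ InCoordinateScope 2
      (CentreBlowup.step 2 {0, 2, 3} 2 b
        (⟨MvPolynomial.map (ZMod.castHom (dvd_refl 2) K) cubicSpec.toState.F, cubicSpec.toState.r, cubicSpec.toState.exc⟩ :
          State K)).F := by
  refine not_inCoordinateScope_step_cast_of_gcdLeafB gcdLeafB_cubicSpec K b
    (fun i hi => by rw [Finset.mem_singleton] at hi; rw [hi, hb3]) ?_
  simpa [monomial_expo_eq, Fin.prod_univ_four, add_assoc] using hZ

end Acceptance

end ScopeBlind

end Summit.ResolutionOfSingularities.ResolutionOfSingularities.Theorems.PIDim4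

end
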